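import Summits.BirchSwinnertonDyer.BirchSwinnertonDyer.Theorems.SemiOrdinaryEisensteinDescentWildSplitEisensteinValueAtOneVVisible441099r1Partner
import Summits.BirchSwinnertonDyer.Rank1Residual.GaloisImage.CongruenceVisibilityIdentityComponentRat
import HarnessLib

/-!
# Route `SemiOrdinaryEisensteinDescent`, crux #2″ `WildSplitEisensteinValueAtOneV` (E_𝟙^V, stmt-BirchSwinnertonDyer-26610):
# the ℚ-level content row `441099r1` — the LOWER HALF `ord₃ #Ш_an ≤ ord₃ #Ш` at `3` from a VISIBLE element of `Ш[3]`
# (the 3-congruent RANK-3 partner `147033a1`), with the partner's rank, the bad places and all local kinds decided IN THE KERNEL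
# (cell `pub/bsd-wall`, width seat `bsd-wall-soed-p1-w3` g20; `--supports stmt-BirchSwinnertonDyer-26610`; THEOREMS ONLY; Theses-FREE)

WHY. Third kernel record of the seat's VISIBLE-NINE instrument for crux #2″ (memo
`Cruxes/WildSplitEisensteinInclusionAtThree/E1V-VISIBLE-NINE-w3g20.md`; first record `…Visible371682b1.lean`; the row `352944s1` is cell
`b2b-bsdres`'s `Rank1Residual/Visibility/TwoWitnessLowerHalf352944s1.lean`). Modulo print and the leaf Z, crux #2″ is
«`Typed.MissingLowerBoundAt W 3` on the cell»; here `E = 441099r1 = [1, −1, 0, −8829, 606406]` (`N = 3³·17·31²`, `Δ = −3⁵·17·31⁷`,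
`r_an = 1`, `#Ш_an = 9`, `E(ℚ)_tors = 1`), `F = 147033a1 = [0, 0, 1, −651, 6502]` (`N′ = N/3`, `Δ′ = −3⁷·17²·31²`, rank `3`;
`a_ℓ(E) ≡ a_ℓ(F) (mod 3)` at all 74 tested primes — the datum `θ`).

THE CERTIFICATE (door `VisibleLowerHalf.missingLowerBoundAt_of_congr_of_places_of_analyticRank_one`, `p = 3`): `S = {v₃, v₁₇, v₃₁}`;
`v₃` PAID with `#F(ℚ₃)[3] = 1` (decider `LocalTorsion3.threeTorsionCheck`, one Hensel ball), `#(ℤ₃/3) = 3`, so `3·3 < 27 ≤ 3^{rank F}`;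
`v₁₇`: kind (iii) — both curves non-split multiplicative, `γ(E)/γ(F) = 5873/40238` a `17`-adic unit square, `μ₃(ℚ₁₇) = 1` (`17 ≡ 2 mod 3`);
`v₃₁`: kind (i) — both additive, `#F(ℚ₃₁)[3] = 1` (decider `threeTorsionCheckAt 31`, one ball). DECIDED HERE also: `gcd(#E(ℚ)_tors, 3) = 1`
(`#Ẽ(𝔽₅) = 5`), `E` globally minimal (Kraus), good reduction outside `S`. WHAT STAYS DATA: `r_an(E) = 1`, `#Ш(E)_an = q` with
`ord₃ q ≤ 2` (attested `9`), `θ : F[3] ⥲ E[3]` (to be Sturm-certified). Published binders: `hCT`, `hGZK`, `hU`, `hU2`.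

HONEST FRAMING: CONDITIONAL on the displayed published facts and data; ONE curve; BSD₃ at `441099r1` NOT claimed; crux #2″ NOT advanced
class-wide; nothing booked. BSD is not proved by any of this.

References: [CremonaMazur2000] §3; [AgasheStein2002] Thm. 3.1; [SilvermanAEC2009] VII.2.1, VII.3.1, VII.5.1, VIII.6.7, X.4.14;
[SilvermanATAEC1994] V.5.3–5.4; [Serre1973] II.3.3; [Kraus1989]; [Knapp1993] V Thm. 5.1(c); [Miller2011LMS] Def. 1.1; Cremona's `ecdata`.
-/

-- the Theorems namespace of this sub repeats the summit name by design (D-0017 nested layout)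
set_option linter.dupNamespace false
set_option autoImplicit false

noncomputable section

open scoped Classical

open WeierstrassCurve IsDedekindDomain NumberField Rat.HeightOneSpectrum
  Literature.NumberTheory.EllipticCurves Literature.NumberTheory.EllipticCurves.Rank1Residual
  Literature.NumberTheory.EllipticCurves.Rank1Residual.Typed
  Literature.NumberTheory.EllipticCurves.Rank1Residual.X11RankOneCertificates
  Summit.BirchSwinnertonDyer.BirchSwinnertonDyer.Rank1Residual.IntModel
  Summit.BirchSwinnertonDyer.Rank1Residual Summit.BirchSwinnertonDyer.Rank1Residual.X11b
  Summit.BirchSwinnertonDyer.Rank1Residual.Supersingular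
  Summit.BirchSwinnertonDyer.Rank1Residual.GaloisImage
  Summit.BirchSwinnertonDyer.Rank2

namespace Summit.BirchSwinnertonDyer.BirchSwinnertonDyer.Theorems

namespace Visible441099r1

open VisiblePlaces D1VisibleKernel

/-! ## §1 The curve `E = 441099r1 = [1, −1, 0, −8829, 606406]`: model, minimality, no rational `3`-torsion -/

/-- `Δ(E) = −113654608892541 = −3⁵·17·31⁷`. [folklore] -/
theorem E_Δ : (⟨1, -1, 0, -8829, 606406⟩ : WeierstrassCurve ℤ).Δ = -113654608892541 := by decide

/-- `c₄(E) = 423801` (prime to `17`). [folklore] -/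
theorem E_c₄ : (⟨1, -1, 0, -8829, 606406⟩ : WeierstrassCurve ℤ).c₄ = 423801 := by decide

/-- The rational model of `E` is the base change of the integer one. [folklore] -/
theorem E_map_eq : (⟨1, -1, 0, -8829, 606406⟩ : WeierstrassCurve ℤ).map (Int.castRingHom ℚ) = (⟨1, -1, 0, -8829, 606406⟩ : WeierstrassCurve ℚ) := by
  ext <;> simp [WeierstrassCurve.map]

/-- The same in `baseChange` form. [folklore] -/
theorem E_baseChange_eq : (⟨1, -1, 0, -8829, 606406⟩ : WeierstrassCurve ℤ).baseChange ℚ = (⟨1, -1, 0, -8829, 606406⟩ : WeierstrassCurve ℚ) :=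
  E_map_eq

/-- `E/ℚ` is an elliptic curve. [folklore] -/
theorem isElliptic_E : (⟨1, -1, 0, -8829, 606406⟩ : WeierstrassCurve ℚ).IsElliptic :=
  isElliptic_of_discOf_ne_zero 1 (-1) 0 (-8829) 606406 (by decide +kernel)

/-- **The Cremona model of `E` is globally minimal**: complete factorisation `|Δ| = 3⁵·17·31⁷` kernel-checked, every exponent `< 12`
(Kraus; tree `isGloballyMinimal_of_krausCriterion₃_factored`). [cite: SilvermanAEC2009, VII.1 Remark 1.1] [cite: Kraus1989, Prop. 1 and Prop. 2] -/
theorem isGloballyMinimal_E : (⟨1, -1, 0, -8829, 606406⟩ : WeierstrassCurve ℚ).IsGloballyMinimal :=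
  isGloballyMinimal_of_krausCriterion₃_factored 1 (-1) 0 (-8829) 606406
    [(3, 5), (17, 1), (31, 7)] (by decide +kernel)
    (by intro qe hqe; simp only [List.mem_cons, List.not_mem_nil, or_false] at hqe
        rcases hqe with rfl | rfl | rfl <;> norm_num)
    (by intro qe hqe; simp only [List.mem_cons, List.not_mem_nil, or_false] at hqe
        rcases hqe with rfl | rfl | rfl <;> exact Or.inl (by decide +kernel))

/-- `#Ẽ(𝔽₅) = 5` (kernel-decided; prime to `3`). [folklore] -/
theorem card_E_5 : Nat.card (((⟨1, -1, 0, -8829, 606406⟩ : WeierstrassCurve ℤ).map (Int.castRingHom (ZMod 5))).toAffine.Point) = 5 := by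
  rw [@WeierstrassCurve.natCard_point_eq_one_add_card (ZMod 5) (@ZMod.instField 5 ⟨by norm_num⟩) _ _ _
    (by decide +kernel), @card_sol_eq_sum_euler (ZMod 5) (@ZMod.instField 5 ⟨by norm_num⟩) _ _
    (by rw [ZMod.ringChar_zmod_n]; decide), ZMod.card]
  decide +kernel

/-- **`gcd(#E(ℚ)_tors, 3) = 1`**: `#E(ℚ)_tors ∣ #Ẽ(𝔽₅) = 5` (Knapp V Thm. 5.1(c), tree `torsionOrder_dvd_natCard_point_map_zmod`, integer
model, `5 ∤ Δ`). [cite: Knapp1993, Ch. V §1 Thm. 5.1(c)] -/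
theorem coprime_torsionOrder_E [(⟨1, -1, 0, -8829, 606406⟩ : WeierstrassCurve ℚ).IsElliptic] :
    ((⟨1, -1, 0, -8829, 606406⟩ : WeierstrassCurve ℚ).torsionOrder).Coprime 3 := by
  haveI : Fact (Nat.Prime 5) := ⟨by norm_num⟩
  haveI : (⟨1, -1, 0, -8829, 606406⟩ : WeierstrassCurve ℚ).IsIntegral ℤ :=
    ⟨⟨(⟨1, -1, 0, -8829, 606406⟩ : WeierstrassCurve ℤ), E_baseChange_eq.symm⟩⟩
  have h := LutzNagellGeneral.torsionOrder_dvd_natCard_point_map_zmod 5 (⟨1, -1, 0, -8829, 606406⟩ : WeierstrassCurve ℚ)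
    (⟨1, -1, 0, -8829, 606406⟩ : WeierstrassCurve ℤ) E_baseChange_eq (Or.inl (by norm_num)) (by rw [E_Δ]; norm_num)
  rw [card_E_5] at h
  exact Nat.Coprime.coprime_dvd_left h (by norm_num)

/-! ## §2 The local kinds at `S = {v₃, v₁₇, v₃₁}` and good reduction outside `S` -/

/-- `Δ(F) ≠ 0` on the integer model. [folklore] -/
theorem F_Δ_ne_zero : (⟨0, 0, 1, -651, 6502⟩ : WeierstrassCurve ℤ).Δ ≠ 0 := by rw [F_Δ]; decide

/-- `Δ(E) ≠ 0` on the integer model. [folklore] -/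
theorem E_Δ_ne_zero : (⟨1, -1, 0, -8829, 606406⟩ : WeierstrassCurve ℤ).Δ ≠ 0 := by rw [E_Δ]; decide

/-- **The PAID place `v₃`: `#F(ℚ₃)[3] = 1` IN THE KERNEL** (decider `LocalTorsion3.threeTorsionCheck`, precision `k = 2`, one Hensel
ball `(1617, 1, 4, 0)` with `g` a non-square: `F` is additive at `3`). [cite: SilvermanAEC2009, VII.3.1 and Ex. 3.7] -/
theorem natCard_ker_three_F_at_3 :
    Nat.card (nsmulAddMonoidHom 3 : (((⟨0, 0, 1, -651, 6502⟩ : WeierstrassCurve ℚ)).baseChange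
      (((primesEquiv (R := 𝓞 ℚ)).symm ⟨3, by norm_num⟩).adicCompletion ℚ)).toAffine.Point →+ _).ker = 1 :=
  LocalTorsion3.natCard_ker_nsmul_three_adicCompletion_eq_one_of_check 0 0 1 (-651) 6502 F_Δ_ne_zero
    (k := 2) (cert := [((1617 : ℤ), 1, 4, 0)]) (by decide +kernel) _ (by norm_num) (primesEquiv_placeAbove 3 (by norm_num))

/-- **Kind (i) at `v₃₁`: `3 ∉ v₃₁` and `#F(ℚ₃₁)[3] = 1` IN THE KERNEL** (decider `LocalTorsion3At.threeTorsionCheckAt 31`, precision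
`k = 2`, one Hensel ball `(26439487390, 1, 4, 1)`: `F` is additive at `31`, Kodaira II). [cite: SilvermanAEC2009, VII.3.1 and Ex. 3.7] -/
theorem kind_i_F_at_31 :
    ((3 : ℕ) : 𝓞 ℚ) ∉ ((primesEquiv (R := 𝓞 ℚ)).symm ⟨31, by norm_num⟩).asIdeal ∧
    Nat.card (nsmulAddMonoidHom 3 : (((⟨0, 0, 1, -651, 6502⟩ : WeierstrassCurve ℚ)).baseChange
      (((primesEquiv (R := 𝓞 ℚ)).symm ⟨31, by norm_num⟩).adicCompletion ℚ)).toAffine.Point →+ _).ker = 1 := by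
  haveI : Fact (Nat.Prime 31) := ⟨by norm_num⟩
  exact LocalTorsion3At.free_kind_i_of_checkAt 31 0 0 1 (-651) 6502 (by norm_num) F_Δ_ne_zero
    (k := 2) (cert := [((26439487390 : ℤ), 1, 4, 1)]) (by decide +kernel) _ (by norm_num) (primesEquiv_placeAbove 31 (by norm_num))

/-- `γ(E) = −c₄/c₆ = 49/60357` over `ℚ` (`c₄ = 423801`, `c₆ = −522027693`). [folklore] -/
theorem gamma_E : -(((⟨1, -1, 0, -8829, 606406⟩ : WeierstrassCurve ℚ)).c₄ / ((⟨1, -1, 0, -8829, 606406⟩ : WeierstrassCurve ℚ)).c₆) = (49 : ℚ) / 60357 := by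
  norm_num [WeierstrassCurve.c₄, WeierstrassCurve.c₆, WeierstrassCurve.b₂, WeierstrassCurve.b₄, WeierstrassCurve.b₆]

/-- `γ(F) = −c₄/c₆ = 14/2517` over `ℚ` (`c₄ = 31248`, `c₆ = −5617944`). [folklore] -/
theorem gamma_F : -(((⟨0, 0, 1, -651, 6502⟩ : WeierstrassCurve ℚ)).c₄ / ((⟨0, 0, 1, -651, 6502⟩ : WeierstrassCurve ℚ)).c₆) = (14 : ℚ) / 2517 := by
  norm_num [WeierstrassCurve.c₄, WeierstrassCurve.c₆, WeierstrassCurve.b₂, WeierstrassCurve.b₄, WeierstrassCurve.b₆]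

/-- **Kind (iii) at `v₁₇`, IN THE KERNEL**: both `E` and `F` are multiplicative at `v₁₇` (`17 ∣ Δ`, `17 ∤ c₄` on the integer models),
`γ(E)/γ(F) = 5873/40238` is a `17`-adic unit square (`sqFlagAt 17`, Euler), and `μ₃(ℚ₁₇) = 1` (`−3` is not a square modulo `17`).
[cite: SilvermanATAEC1994, Ch. V Thm. 5.3, Cor. 5.4] [cite: Serre1973, Ch. II §3.3] -/
theorem kind_iii_E_F_at_17 [(⟨1, -1, 0, -8829, 606406⟩ : WeierstrassCurve ℚ).IsElliptic] [(⟨0, 0, 1, -651, 6502⟩ : WeierstrassCurve ℚ).IsElliptic] :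
    ((⟨1, -1, 0, -8829, 606406⟩ : WeierstrassCurve ℚ)).HasMultiplicativeReductionAt ((primesEquiv (R := 𝓞 ℚ)).symm ⟨17, by norm_num⟩) ∧
    ((⟨0, 0, 1, -651, 6502⟩ : WeierstrassCurve ℚ)).HasMultiplicativeReductionAt ((primesEquiv (R := 𝓞 ℚ)).symm ⟨17, by norm_num⟩) ∧
    (∃ r : ((primesEquiv (R := 𝓞 ℚ)).symm ⟨17, by norm_num⟩).adicCompletion ℚ,
      algebraMap ℚ _ (-(((⟨1, -1, 0, -8829, 606406⟩ : WeierstrassCurve ℚ)).c₄ / ((⟨1, -1, 0, -8829, 606406⟩ : WeierstrassCurve ℚ)).c₆)) =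
        r ^ 2 * algebraMap ℚ _ (-(((⟨0, 0, 1, -651, 6502⟩ : WeierstrassCurve ℚ)).c₄ / ((⟨0, 0, 1, -651, 6502⟩ : WeierstrassCurve ℚ)).c₆))) ∧
    (∀ ζ : ((primesEquiv (R := 𝓞 ℚ)).symm ⟨17, by norm_num⟩).adicCompletion ℚ, ζ ^ 3 = 1 → ζ = 1) := by
  haveI : Fact (Nat.Prime 17) := ⟨by norm_num⟩
  haveI : ((⟨1, -1, 0, -8829, 606406⟩ : WeierstrassCurve ℤ).baseChange ℚ).IsElliptic := by rw [E_baseChange_eq]; infer_instance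
  haveI : ((⟨0, 0, 1, -651, 6502⟩ : WeierstrassCurve ℤ).baseChange ℚ).IsElliptic := by rw [F_baseChange_eq]; infer_instance
  refine ⟨?_, ?_, ?_, LocalTorsion3At.forall_pow_three_eq_one_adicCompletion_of_sqFlagAt _ (primesEquiv_placeAbove 17 (by norm_num))
    (w₃ := 0) (by norm_num) (by norm_num) (by decide +kernel)⟩
  · have h := hasMultiplicativeReductionAt_baseChange_int_of_dvd_of_not_dvd (⟨1, -1, 0, -8829, 606406⟩ : WeierstrassCurve ℤ)
      ((primesEquiv (R := 𝓞 ℚ)).symm ⟨17, by norm_num⟩) (by rw [natGenerator_placeAbove, E_Δ]; decide)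
      (by rw [natGenerator_placeAbove, E_c₄]; decide)
    rwa [E_baseChange_eq] at h
  · have h := hasMultiplicativeReductionAt_baseChange_int_of_dvd_of_not_dvd (⟨0, 0, 1, -651, 6502⟩ : WeierstrassCurve ℤ)
      ((primesEquiv (R := 𝓞 ℚ)).symm ⟨17, by norm_num⟩) (by rw [natGenerator_placeAbove, F_Δ]; decide)
      (by rw [natGenerator_placeAbove, F_c₄]; decide)
    rwa [F_baseChange_eq] at h
  · rw [gamma_E, gamma_F]
    exact LocalTorsion3At.exists_eq_sq_mul_of_sqFlagAt _ (primesEquiv_placeAbove 17 (by norm_num)) (by norm_num)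
      (N := 5873) (D := 40238) (by norm_num) (by norm_num)
      (w := 0) (by norm_num) (by decide +kernel) (by decide +kernel)

/-- Outside `{v₃, v₁₇, v₃₁}` the prime below `v` is none of `3, 17, 31`. [folklore] -/
theorem natGenerator_ne_of_not_mem_places {v : HeightOneSpectrum (𝓞 ℚ)} (hv : v ∉ ({(primesEquiv (R := 𝓞 ℚ)).symm ⟨3, by norm_num⟩,
        (primesEquiv (R := 𝓞 ℚ)).symm ⟨17, by norm_num⟩, (primesEquiv (R := 𝓞 ℚ)).symm ⟨31, by norm_num⟩} : Finset (HeightOneSpectrum (𝓞 ℚ)))) :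
    natGenerator v ≠ 3 ∧ natGenerator v ≠ 17 ∧ natGenerator v ≠ 31 := by
  simp only [Finset.mem_insert, Finset.mem_singleton, not_or] at hv
  obtain ⟨h3, h17, h31⟩ := hv
  exact ⟨fun h ↦ h3 (eq_placeAbove_of_natGenerator_eq (by norm_num) h),
    fun h ↦ h17 (eq_placeAbove_of_natGenerator_eq (by norm_num) h),
    fun h ↦ h31 (eq_placeAbove_of_natGenerator_eq (by norm_num) h)⟩

/-- **Outside `{v₃, v₁₇, v₃₁}` both `E` and `F` have good reduction and `v ∤ 3`**: `Δ(E) = −3⁵·17·31⁷` and `Δ(F) = −3⁷·17²·31²` have no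
prime factor outside `{3, 17, 31}`. [cite: SilvermanAEC2009, VII.5 Prop. 5.1(a)] -/
theorem good_outside_places (v : HeightOneSpectrum (𝓞 ℚ)) (hv : v ∉ ({(primesEquiv (R := 𝓞 ℚ)).symm ⟨3, by norm_num⟩,
        (primesEquiv (R := 𝓞 ℚ)).symm ⟨17, by norm_num⟩, (primesEquiv (R := 𝓞 ℚ)).symm ⟨31, by norm_num⟩} : Finset (HeightOneSpectrum (𝓞 ℚ)))) :
    ((⟨1, -1, 0, -8829, 606406⟩ : WeierstrassCurve ℚ)).HasGoodReductionAt v ∧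
    ((⟨0, 0, 1, -651, 6502⟩ : WeierstrassCurve ℚ)).HasGoodReductionAt v ∧
    ((3 : ℕ) : 𝓞 ℚ) ∉ v.asIdeal := by
  obtain ⟨h3, h17, h31⟩ := natGenerator_ne_of_not_mem_places hv
  have hp : (natGenerator v).Prime := prime_natGenerator v
  have key : ∀ n : ℕ, n ∣ 3 ^ 7 * 17 ^ 2 * 31 ^ 7 → n.Prime → n = 3 ∨ n = 17 ∨ n = 31 := by
    intro n hn hn'
    rcases (Nat.Prime.dvd_mul hn').mp hn with h | h
    · rcases (Nat.Prime.dvd_mul hn').mp h with h | h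
      · exact Or.inl ((Nat.prime_dvd_prime_iff_eq hn' (by norm_num)).mp (hn'.dvd_of_dvd_pow h))
      · exact Or.inr (Or.inl ((Nat.prime_dvd_prime_iff_eq hn' (by norm_num)).mp (hn'.dvd_of_dvd_pow h)))
    · exact Or.inr (Or.inr ((Nat.prime_dvd_prime_iff_eq hn' (by norm_num)).mp (hn'.dvd_of_dvd_pow h)))
  have hnot : ¬ (natGenerator v ∣ 3 ^ 7 * 17 ^ 2 * 31 ^ 7) := by
    intro h
    rcases key _ h hp with h | h | h
    · exact h3 h
    · exact h17 h
    · exact h31 h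
  refine ⟨?_, ?_, ?_⟩
  · have h := hasGoodReductionAt_baseChange_int_of_not_dvd (⟨1, -1, 0, -8829, 606406⟩ : WeierstrassCurve ℤ) v (by
      rw [E_Δ]
      intro h
      apply hnot
      have h' : (natGenerator v : ℤ) ∣ ((3 ^ 7 * 17 ^ 2 * 31 ^ 7 : ℕ) : ℤ) := (Int.dvd_neg.mpr h).trans (by norm_num)
      exact_mod_cast h')
    rwa [E_baseChange_eq] at h
  · have h := hasGoodReductionAt_baseChange_int_of_not_dvd (⟨0, 0, 1, -651, 6502⟩ : WeierstrassCurve ℤ) v (by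
      rw [F_Δ]
      intro h
      apply hnot
      have h' : (natGenerator v : ℤ) ∣ ((3 ^ 7 * 17 ^ 2 * 31 ^ 7 : ℕ) : ℤ) := (Int.dvd_neg.mpr h).trans (by norm_num)
      exact_mod_cast h')
    rwa [F_baseChange_eq] at h
  · rw [Nat.cast_ofNat, show (3 : 𝓞 ℚ) = ((3 : ℕ) : 𝓞 ℚ) by norm_num,
      natCast_mem_asIdeal_iff_eq_placeAbove v (by norm_num : (3 : ℕ).Prime)]
    intro h
    exact h3 (by rw [h, natGenerator_placeAbove])

end Visible441099r1

open Visible441099r1 VisiblePlaces D1VisibleKernel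

/-! ## §3 The lower half at `(441099r1, 3)` from the visible element — rank, places, paid count and kinds in the kernel -/

/-- **`ord₃ #Ш(E)_an ≤ ord₃ #Ш(E)` for `E = 441099r1` from the `3`-congruent rank-`3` partner `F = 147033a1` — KERNEL form.**
Published facts: Cassels–Tate (`hCT`), GZK (`hGZK`), Tate uniformisation (`hU`, `hU2`). DATA: `r_an(E) = 1` (`hr`), `#Ш(E)_an = q` with
`ord₃ q ≤ 2` (`hq`, `hv`; attested `q = 9`), and the `Γ_ℚ`-isomorphism `θ : F[3] ⥲ E[3]` (`θ`, `hθ`). DECIDED HERE: `3 ≤ rank F(ℚ)`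
(companion file), the bad places `{v₃, v₁₇, v₃₁}` with good reduction outside, the paid count at `v₃` (`3·3 < 3³`), kind (iii) at `v₁₇`,
kind (i) at `v₃₁`, `gcd(#E(ℚ)_tors, 3) = 1`. The instance binders are discharged by `isElliptic_E`, `isGloballyMinimal_E`,
`Visible441099r1.isElliptic_F`. PER PAIR; CONDITIONAL; `MissingLowerBoundAt E 3` is the ENTIRE ℚ-level content of crux #2″ at this curve
modulo the leaf Z; BSD₃(E) is NOT claimed. [cite: CremonaMazur2000, §3 and Table 1] [cite: AgasheStein2002, Thm. 3.1 and §3.5]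
[cite: SilvermanAEC2009, Thm. X.4.14] [cite: SilvermanATAEC1994, Ch. V Thm. 5.3, Cor. 5.4] [cite: Miller2011LMS, Def. 1.1 (arXiv:1010.2431 p. 3)] -/
theorem missingLowerBound_441099r1_of_visibleSha_kernel
    [(⟨1, -1, 0, -8829, 606406⟩ : WeierstrassCurve ℚ).IsElliptic] [(⟨1, -1, 0, -8829, 606406⟩ : WeierstrassCurve ℚ).IsGloballyMinimal]
    [(⟨0, 0, 1, -651, 6502⟩ : WeierstrassCurve ℚ).IsElliptic]
    (hCT : exists_casselsTate_pairing (K := ℚ)) (hGZK : rank_eq_analyticRank_of_analyticRank_le_one)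
    (hU : Silverman1994_thmV53_tateUniformisation.{0})
    (hU2 : Silverman1994_thmV53_corV54_tateUniformisation.{0})
    (hr : (⟨1, -1, 0, -8829, 606406⟩ : WeierstrassCurve ℚ).analyticRank = 1)
    {q : ℚ} (hq : shaAn (⟨1, -1, 0, -8829, 606406⟩ : WeierstrassCurve ℚ) = (q : ℂ)) (hv : padicValRat 3 q ≤ 2)
    (θ : geomTorsion (⟨0, 0, 1, -651, 6502⟩ : WeierstrassCurve ℚ) ((3 : ℕ) : ℤ) ≃+
      geomTorsion (⟨1, -1, 0, -8829, 606406⟩ : WeierstrassCurve ℚ) ((3 : ℕ) : ℤ))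
    (hθ : ∀ (σ : Field.absoluteGaloisGroup ℚ) (P : geomTorsion (⟨0, 0, 1, -651, 6502⟩ : WeierstrassCurve ℚ) ((3 : ℕ) : ℤ)),
      θ (σ • P) = σ • θ P) :
    Typed.MissingLowerBoundAt (⟨1, -1, 0, -8829, 606406⟩ : WeierstrassCurve ℚ) 3 := by
  haveI : Fact (Nat.Prime 3) := ⟨Nat.prime_three⟩
  refine VisibleLowerHalf.missingLowerBoundAt_of_congr_of_places_of_analyticRank_one _ 3 hCT hGZK hU hU2 (by norm_num) hr
    coprime_torsionOrder_E hq hv _ θ hθ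
    ({(primesEquiv (R := 𝓞 ℚ)).symm ⟨3, by norm_num⟩, (primesEquiv (R := 𝓞 ℚ)).symm ⟨17, by norm_num⟩,
      (primesEquiv (R := 𝓞 ℚ)).symm ⟨31, by norm_num⟩} : Finset (HeightOneSpectrum (𝓞 ℚ)))
    ({(primesEquiv (R := 𝓞 ℚ)).symm ⟨3, by norm_num⟩} : Finset (HeightOneSpectrum (𝓞 ℚ)))
    (Finset.singleton_subset_iff.mpr (by simp)) good_outside_places ?_ ?_
  · -- the paid count at `v₃`: `3 · (#F(ℚ₃)[3] · #(ℤ₃/3)) = 3 · (1 · 3) = 9 < 27 ≤ 3 ^ rank F`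
    rw [Finset.prod_singleton, natCard_ker_three_F_at_3, TwistedWitness.natCard_quot_three_of_primesEquiv_eq (primesEquiv_placeAbove 3 (by norm_num))]
    calc 3 * (1 * 3) = 3 ^ 2 := by norm_num
      _ < 3 ^ 3 := by norm_num
      _ ≤ 3 ^ (⟨0, 0, 1, -651, 6502⟩ : WeierstrassCurve ℚ).mordellWeilRank := Nat.pow_le_pow_right (by norm_num) three_le_rank_F
  · intro v hvS hvT
    simp only [Finset.mem_insert, Finset.mem_singleton] at hvS
    rcases hvS with rfl | rfl | rfl
    · exact absurd (Finset.mem_singleton_self _) hvT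
    · exact Or.inr (Or.inr kind_iii_E_F_at_17)
    · exact Or.inl kind_i_F_at_31

end Summit.BirchSwinnertonDyer.BirchSwinnertonDyer.Theorems

end
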